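import Mathlib
import Literature.Computability.AlgebraicComplexity.PermanentIrreducible

/-!
# `SmallCaseThreeFive` (stmt-ValiantsHypothesis-5644), line `Sketch` — stub `stub_map_det_pencil`

Transfer step "universal nilpotency ⇒ ideal membership": if a ring map `f : S →+* T` kills every
non-permutation coefficient of a polynomial `p` in the `9` variables `x_e` (`e : Fin 3 × Fin 3`)
and identifies all `6` permutation coefficients with `λ := f (coeff of x₁₁ x₂₂ x₃₃)`, then
`map f p = C λ * per₃` in `T[x]`.  The proof compares coefficients, using the description of the
coefficients of the generic permanent (`coeff_permMonomial_perPoly`,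
`exists_permMonomial_eq_of_coeff_perPoly_ne_zero` from
`Literature/Computability/AlgebraicComplexity/PermanentIrreducible.lean`).
-/

noncomputable section
set_option linter.dupNamespace false

namespace Summit.ValiantsHypothesis.ValiantsHypothesis.Theorems.RefutationDegreeSmallCaseThreeFive

open Literature.Computability.AlgebraicComplexity MvPolynomial
open scoped BigOperators

/-- If `f : S →+* T` kills all non-permutation coefficients of `p ∈ S[x_e : e ∈ Fin 3 × Fin 3]`
and sends every permutation coefficient to the image `λ` of the diagonal coefficient
(`permMonomial (Equiv.refl _)`, i.e. `x₀₀ x₁₁ x₂₂`), then `map f p = C λ * per₃`. -/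
theorem stub_map_det_pencil {S T : Type*} [CommRing S] [CommRing T] (f : S →+* T)
    (p : MvPolynomial (Fin 3 × Fin 3) S)
    (h0 : ∀ μ : Fin 3 × Fin 3 →₀ ℕ, μ ∉ Set.range (permMonomial (n := Fin 3)) → f (p.coeff μ) = 0)
    (h1 : ∀ ρ : Equiv.Perm (Fin 3),
      f (p.coeff (permMonomial ρ)) = f (p.coeff (permMonomial (Equiv.refl _)))) :
    MvPolynomial.map (σ := Fin 3 × Fin 3) f p =
      C (f (p.coeff (permMonomial (Equiv.refl _)))) * perPoly (Fin 3) T := by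
  ext μ
  rw [coeff_map, coeff_C_mul]
  by_cases hμ : μ ∈ Set.range (permMonomial (n := Fin 3))
  · obtain ⟨ρ, rfl⟩ := hμ
    rw [coeff_permMonomial_perPoly, mul_one, h1 ρ]
  · have hz : coeff μ (perPoly (Fin 3) T) = 0 := by
      by_contra hne
      exact hμ (Set.mem_range.2 (exists_permMonomial_eq_of_coeff_perPoly_ne_zero T hne))
    rw [h0 μ hμ, hz, mul_zero]

end Summit.ValiantsHypothesis.ValiantsHypothesis.Theorems.RefutationDegreeSmallCaseThreeFive
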